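import Mathlib.FieldTheory.Finite.Polynomial
import Mathlib.Algebra.MvPolynomial.CommRing
import Literature.Computability.Complexity.PolynomialEntropyApproximation

/-!
# PneNP / SzkEntropy — crux `PeaThreeNotInP` (stmt-PneNP-10776), negative side, I: the constant-function test for sparse maps over `F₂`

Route `PneNP/SzkEntropy`, crux X = `PeaThreeNotInP` (`PEA 3 ∉ PromiseP`: no polynomial-time language
separates the sparse cubic maps over `F₂` with `H(p(U_n)) ≥ k + 1` from those with `H ≤ k`).
Mathematical half of the NEGATIVE LEMMA `thresholdZero_slice_separated` (file
`ThresholdZeroSlice.lean`: for EVERY degree `d` the slice `k = 0` of `PEA d` — yes `H ≥ 1`, no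
`H ≤ 0` — is separated in `P`, so the hardness thesis X asserts is quantitative, `k ≥ 1`):

* **`sum_prod_const_iff`** — the constant-function test for ONE sparse polynomial over `F₂` of
  arbitrary degree: `x ↦ ∑_{μ ∈ p} ∏_{i ∈ μ} xᵢ` is constant on `F₂ⁿ` iff every non-empty support
  class `{ν ∈ p : set ν = set μ}` has even size.  Proof: on `F₂`-points a monomial only depends on
  its support (`prod_map_eq_prod_toFinset`), so the polynomial is the evaluation of the
  MULTILINEAR `MvPolynomial` `∑_μ X^{set μ}` (`eval_polyOf`) whose coefficients are the class
  parities (`coeff_polyOf`); a multilinear polynomial vanishing on `F₂ⁿ` is zero (Mathlib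
  `MvPolynomial.eq_zero_of_eval_eq_zero`, degree `< |K|` in each variable).
* `eval_const_iff` — the same for a sparse MAP (all output polynomials).
* Entropy side: `mapEntropy_pos_of_ne` (a non-constant map has `H > 0`), hence
  `eval_const_of_entropy_le_zero`, and `entropy_eq_zero_of_eval_const`.

References: R. O'Donnell, *Analysis of Boolean Functions*, CUP 2014, §6.2 (every `f : F₂ⁿ → F₂` has
a unique multilinear `F₂`-polynomial representation); Z. Dvir, D. Gutfreund, G. N. Rothblum,
S. Vadhan, *On approximating the entropy of polynomial mappings*, ICS 2011 (ECCC TR10-160), §3 p. 6,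
Claim 2.2; S. Arora, B. Barak, *Computational Complexity*, CUP 2009, §1.3, Def. 1.13;
O. Goldreich, *On promise problems* (2006), Def. 1.2.
-/

namespace Summit.PneNP.PneNP.Theorems.PeaThreeNotInP.Negative

set_option linter.dupNamespace false -- `Summit.PneNP.PneNP.…`: summit = sub-problem name (D-0017 single-conjunct layout)

open Literature.Computability.Complexity Literature.InformationTheory.Entropy _root_.Computability
open MvPolynomial

variable {n : ℕ}
/-! ### Multilinear reduction of a monomial -/

/-- On `F₂`-points a monomial only depends on its SET of variables: `∏_{i ∈ μ} xᵢ = ∏_{i ∈ set μ} xᵢ`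
(`xᵢ² = xᵢ`). -/
theorem prod_map_eq_prod_toFinset (μ : List (Fin n)) (x : Fin n → ZMod 2) :
    (μ.map x).prod = ∏ i ∈ μ.toFinset, x i := by
  induction μ with
  | nil => simp
  | cons a μ ih =>
    rw [List.map_cons, List.prod_cons, ih, List.toFinset_cons]
    by_cases ha : a ∈ μ.toFinset
    · rw [Finset.insert_eq_of_mem ha, ← Finset.mul_prod_erase _ _ ha, ← mul_assoc]
      congr 1
      have : ∀ b : ZMod 2, b * b = b := by decide
      exact this _
    · rw [Finset.prod_insert ha]

/-- The exponent vector of a set of variables: `1` on `S`, `0` elsewhere. -/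
theorem expo_apply (S : Finset (Fin n)) (i : Fin n) :
    (∑ j ∈ S, Finsupp.single j (1 : ℕ)) i = if i ∈ S then 1 else 0 := by
  rw [Finsupp.finsetSum_apply]
  simp [Finsupp.single_apply, eq_comm]

/-- The exponent vector determines the set of variables. -/
theorem expo_injective : Function.Injective
    (fun S : Finset (Fin n) => ∑ j ∈ S, Finsupp.single j (1 : ℕ)) := by
  intro S T h
  ext i
  have := congrArg (fun f : Fin n →₀ ℕ => f i) h
  simp only [expo_apply] at this
  by_cases hS : i ∈ S <;> by_cases hT : i ∈ T <;> simp_all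

/-- The exponent vector is `0` exactly for the empty set (the constant monomial). -/
theorem expo_eq_zero_iff (S : Finset (Fin n)) :
    (∑ j ∈ S, Finsupp.single j (1 : ℕ)) = 0 ↔ S = ∅ := by
  constructor
  · intro h
    refine Finset.eq_empty_of_forall_notMem fun i hi => ?_
    have := congrArg (fun f : Fin n →₀ ℕ => f i) h
    simp only [expo_apply, if_pos hi, Finsupp.coe_zero, Pi.zero_apply] at this
    exact one_ne_zero this
  · rintro rfl; simp

/-- The multilinear polynomial of a sparse `F₂`-polynomial (list of monomials): the sum of the
multilinear monomials of the supports. -/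
theorem eval_polyOf (p : List (List (Fin n))) (x : Fin n → ZMod 2) :
    eval x ((p.map fun μ => (monomial (∑ j ∈ μ.toFinset, Finsupp.single j (1 : ℕ)) (1 : ZMod 2))).sum) =
      (p.map fun μ => (μ.map x).prod).sum := by
  induction p with
  | nil => simp
  | cons μ p ih =>
    rw [List.map_cons, List.sum_cons, map_add, ih, List.map_cons, List.sum_cons]
    congr 1
    rw [monomial_sum_one, map_prod, prod_map_eq_prod_toFinset]
    refine Finset.prod_congr rfl fun i _ => ?_
    change eval x (X i) = x i
    exact eval_X _

/-- The coefficient of the multilinear polynomial at the monomial of `S` is the PARITY of the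
support class `{ν ∈ p : set ν = S}`. [O'Donnell 2014, §6.2] -/
theorem coeff_polyOf (p : List (List (Fin n))) (S : Finset (Fin n)) :
    coeff (∑ j ∈ S, Finsupp.single j (1 : ℕ))
        ((p.map fun μ => (monomial (∑ j ∈ μ.toFinset, Finsupp.single j (1 : ℕ)) (1 : ZMod 2))).sum) =
      ((p.countP fun ν => decide (ν.toFinset = S) : ℕ) : ZMod 2) := by
  induction p with
  | nil => simp
  | cons μ p ih =>
    rw [List.map_cons, List.sum_cons, coeff_add, ih, List.countP_cons, coeff_monomial]
    by_cases h : μ.toFinset = S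
    · subst h
      simp [add_comm]
    · have h' : (∑ j ∈ μ.toFinset, Finsupp.single j (1 : ℕ)) ≠ ∑ j ∈ S, Finsupp.single j 1 :=
        fun he => h (expo_injective he)
      simp [h', h]

/-- Every monomial of the multilinear polynomial is the monomial of some support class. -/
theorem support_polyOf_subset (p : List (List (Fin n))) :
    ((p.map fun μ => (monomial (∑ j ∈ μ.toFinset, Finsupp.single j (1 : ℕ)) (1 : ZMod 2))).sum).support ⊆
      (p.map fun μ => ∑ j ∈ μ.toFinset, Finsupp.single j (1 : ℕ)).toFinset := by
  classical
  induction p with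
  | nil => simp
  | cons μ p ih =>
    rw [List.map_cons, List.sum_cons, List.map_cons, List.toFinset_cons]
    refine support_add.trans (Finset.union_subset ?_ (ih.trans (Finset.subset_insert _ _)))
    exact (support_monomial_subset).trans (Finset.singleton_subset_iff.2 (Finset.mem_insert_self _ _))

/-- The multilinear polynomial (minus any constant) has degree `≤ 1` in each variable. -/
theorem polyOf_sub_C_mem_restrictDegree (p : List (List (Fin n))) (c : ZMod 2) :
    (p.map fun μ => (monomial (∑ j ∈ μ.toFinset, Finsupp.single j (1 : ℕ)) (1 : ZMod 2))).sum - C c ∈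
      restrictDegree (Fin n) (ZMod 2) 1 := by
  classical
  rw [mem_restrictDegree]
  intro s hs i
  have hs' := support_sub (σ := Fin n) _ _ hs
  rw [Finset.mem_union] at hs'
  rcases hs' with hs' | hs'
  · have := support_polyOf_subset p hs'
    rw [List.mem_toFinset, List.mem_map] at this
    obtain ⟨μ, -, rfl⟩ := this
    rw [expo_apply]
    split <;> simp
  · have hC : (C c : MvPolynomial (Fin n) (ZMod 2)).support ⊆ {0} := by
      rw [C_apply]; exact support_monomial_subset
    have := hC hs'
    rw [Finset.mem_singleton] at this
    subst this
    simp

/-- **Constant-function test for one sparse polynomial over `F₂`.** The function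
`x ↦ ∑_{μ ∈ p} ∏_{i ∈ μ} xᵢ` on `F₂ⁿ` is constant iff every NON-EMPTY support class
`{ν ∈ p : set ν = set μ}` has even size (the multilinear normal form has no non-constant term).
[O'Donnell, *Analysis of Boolean Functions*, Thm 1.1 / §6.2 (F₂-polynomial representation is unique)] -/
theorem sum_prod_const_iff (p : List (List (Fin n))) :
    (∀ x y : Fin n → ZMod 2,
        (p.map fun μ => (μ.map x).prod).sum = (p.map fun μ => (μ.map y).prod).sum) ↔
      ∀ μ ∈ p, μ ≠ [] → (p.countP fun ν => decide (ν.toFinset = μ.toFinset)) % 2 = 0 := by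
  classical
  set Q : MvPolynomial (Fin n) (ZMod 2) :=
    (p.map fun μ => (monomial (∑ j ∈ μ.toFinset, Finsupp.single j (1 : ℕ)) (1 : ZMod 2))).sum with hQ
  constructor
  · intro hconst μ hμ hne
    -- `Q - C (Q(0))` vanishes everywhere and is multilinear, hence zero
    set c : ZMod 2 := (p.map fun μ => (μ.map (0 : Fin n → ZMod 2)).prod).sum with hc
    have hzero : Q - C c = 0 := by
      refine eq_zero_of_eval_eq_zero (Fin n) (ZMod 2) (Q - C c) (fun v => ?_) ?_
      · rw [map_sub, eval_C, hQ, eval_polyOf, hconst v 0, hc, sub_self]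
      · have : Fintype.card (ZMod 2) - 1 = 1 := by rw [ZMod.card]
        rw [this, hQ]
        exact polyOf_sub_C_mem_restrictDegree p c
    have hQc : Q = C c := sub_eq_zero.1 hzero
    have hcoeff := coeff_polyOf p μ.toFinset
    rw [← hQ, hQc, coeff_C] at hcoeff
    have hne' : (0 : Fin n →₀ ℕ) ≠ ∑ j ∈ μ.toFinset, Finsupp.single j 1 := by
      intro h0
      have := (expo_eq_zero_iff μ.toFinset).1 h0.symm
      rw [List.toFinset_eq_empty_iff] at this
      exact hne this
    rw [if_neg hne'] at hcoeff
    have h2 : (2 : ℕ) ∣ p.countP fun ν => decide (ν.toFinset = μ.toFinset) :=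
      (ZMod.natCast_eq_zero_iff _ _).1 hcoeff.symm
    exact Nat.mod_eq_zero_of_dvd h2
  · intro heven x y
    -- all non-constant coefficients vanish, so `Q = C (coeff 0 Q)`
    have hQc : Q = C (coeff 0 Q) := by
      ext s
      rw [coeff_C]
      split_ifs with hs
      · rw [← hs]
      · -- `s` is in the support only if `s = e S` for a class `S`; then the coefficient is a parity
        by_contra hne
        have hmem : s ∈ Q.support := mem_support_iff.2 hne
        have := support_polyOf_subset p hmem
        rw [List.mem_toFinset, List.mem_map] at this
        obtain ⟨μ, hμ, rfl⟩ := this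
        have hμne : μ ≠ [] := by
          rintro rfl
          exact hs (by simp)
        have hc := coeff_polyOf p μ.toFinset
        rw [← hQ] at hc
        have h0 : ((p.countP fun ν => decide (ν.toFinset = μ.toFinset) : ℕ) : ZMod 2) = 0 := by
          rw [ZMod.natCast_eq_zero_iff]
          exact Nat.dvd_of_mod_eq_zero (heven μ hμ hμne)
        exact hne (by rw [hc, h0])
    have hx := eval_polyOf p x
    have hy := eval_polyOf p y
    rw [← hQ] at hx hy
    rw [← hx, ← hy, hQc, eval_C, eval_C]


/-! ### Constant maps and entropy -/

/-- A sparse MAP is constant on `F₂ⁿ` iff each output polynomial passes the class-parity test. -/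
theorem eval_const_iff (P : PolyMapF2 n) :
    (∀ x y : Fin n → ZMod 2, P.eval x = P.eval y) ↔
      ∀ p ∈ P, ∀ μ ∈ p, μ ≠ [] → (p.countP fun ν => decide (ν.toFinset = μ.toFinset)) % 2 = 0 := by
  constructor
  · intro h p hp
    refine (sum_prod_const_iff p).1 fun x y => ?_
    have := h x y
    unfold PolyMapF2.eval at this
    exact List.map_inj_left.1 this p hp
  · intro h x y
    unfold PolyMapF2.eval
    exact List.map_inj_left.2 fun p hp => (sum_prod_const_iff p).2 (h p hp) x y

/-- **A non-constant map has positive output entropy**: if `f v ≠ f w` for some `v, w ∈ S` then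
`H(f(U_S)) > 0` (the fibre through `v` misses `w`, so its surprise is positive).
[Cover–Thomas, 2nd ed., Lemma 2.1.1 neighbourhood] -/
theorem mapEntropy_pos_of_ne {ι β : Type*} [DecidableEq β] {S : Finset ι} {f : ι → β} {v w : ι}
    (hv : v ∈ S) (hw : w ∈ S) (hne : f v ≠ f w) : 0 < mapEntropy S f := by
  classical
  unfold mapEntropy
  have hS : (0 : ℝ) < S.card := by exact_mod_cast Finset.card_pos.2 ⟨v, hv⟩
  refine div_pos (Finset.sum_pos' (fun u hu => logb_card_div_card_fiber_nonneg f hu) ⟨v, hv, ?_⟩) hS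
  have hlt : (fiber S f (f v)).card < S.card := by
    refine Finset.card_lt_card ⟨fiber_subset S f (f v), fun hsub => ?_⟩
    have := mem_fiber.1 (hsub hw)
    exact hne this.2.symm
  have hF : (0 : ℝ) < (fiber S f (f v)).card := by exact_mod_cast card_fiber_pos f hv
  refine Real.logb_pos (by norm_num) ?_
  rw [lt_div_iff₀ hF, one_mul]
  exact_mod_cast hlt

/-- `H(P(U_n)) ≤ 0` forces `P` to be constant on `F₂ⁿ`. [DvirGutfreundRothblumVadhan2010, Claim 2.2] -/
theorem eval_const_of_entropy_le_zero {P : PolyMapF2 n} (h : P.entropy ≤ 0) (x y : Fin n → ZMod 2) :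
    P.eval x = P.eval y := by
  by_contra hne
  have := mapEntropy_pos_of_ne (S := Finset.univ) (f := P.eval) (Finset.mem_univ x) (Finset.mem_univ y) hne
  exact absurd h (not_le.2 this)

/-- A constant map has entropy `0`. [DvirGutfreundRothblumVadhan2010, Claim 2.2] -/
theorem entropy_eq_zero_of_eval_const {P : PolyMapF2 n} (h : ∀ x y : Fin n → ZMod 2, P.eval x = P.eval y) :
    P.entropy = 0 := by
  have hc : P.eval = fun _ => P.eval 0 := funext fun x => h x 0
  unfold PolyMapF2.entropy
  rw [hc]
  exact Literature.InformationTheory.Entropy.mapEntropy_const _ _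

end Summit.PneNP.PneNP.Theorems.PeaThreeNotInP.Negative
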